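import Summits.AnomalousDissipation.AnomalousDissipation.Theorems.SolenoidalFractalHomogenisationLagrangianStepCellLawVOddGainDefectPairing
import Mathlib.Analysis.SpecialFunctions.Integrals.Basic
import HarnessLib

/-!
# K1L `LagrangianRenormalisationStep(Design)` (K1L_D, stmt-AnomalousDissipation-27980; aside 24912), stub `stub_cellLawV0_IS`
# — W5 odd half, O2⁺ (ii): `LowerEdgeTarget` PROVED, the SECOND-ORDER lower edge, and the SECTOR GROWTH of the slot response `f_T`
# (helper; `--supports stmt-AnomalousDissipation-27980`; word-independent)

Summits-side helper file of route `SolenoidalFractalHomogenisation` (prover seat `ad-k1l-cellLawV-w1` g2; tenure D24-14 «prove `LowerEdgeTarget(Sharp)`,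
assemble odd (W)»), second of two files, on top of `…CellLawVOddGainDefectPairing.lean` (the Duhamel pairing identity and the first-order drift).
For a block `B` in the Kato sector `τ` (`(xᵀBz − zᵀBx)² ≤ τ²·xᵀBx·zᵀBz`) with window `lo|x|² ≤ xᵀBx ≤ hi|x|²` (`0 < lo`), `H = ½(B + Bᵀ)`:
* §3b pointwise in `t ≥ 0`: **`lowerEdge_pointwise_second`** `vᵀe^{-tB}v ≥ (e^{-hi t} − (τhi)²/8·t²·e^{-lo t})|v|²` — in the pairing identity
  at `z = v` the integrand splits as `(e^{-(t-r)H}v)·(M e^{-rH}v) + (e^{-(t-r)H}v)·(M w(r))`, `M = ½(Bᵀ − B)` skew, `w = e^{-·B}v − e^{-·H}v`;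
  the first term is ODD under `r ↦ t − r` so its integral vanishes (`intervalIntegral.integral_comp_sub_left`), the second is second order;
  **`abs_dotProduct_exp_sub_comm_le`** `|z·(e^{-tB}v) − v·(e^{-tB}z)| ≤ τ·hi·t·e^{-lo t}√(z·z)√(v·v)` (pairing identity with `C = B`).
* §4 the slot functional `g ↦ T∫₀¹a(s)∫₀ˢa(x)g(T(s−x))` of p643071's `qsResp` is monotone (`qsKernel_mono`, the two-rate variant of
  `le_sum_sum_mul_qsResp_mul`) and linear (`qsKernel_lin`); `form_qsResp_eq`.  Hence:
  **`lowerEdgeTarget_holds : ∀ ρ, LowerEdgeTarget ρ`** — p5 §5's typed first-order target `vᵀf_T(B)v ≥ (f_T(hi) − (τhi/2)g_T(lo))|v|²` is a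
  THEOREM, so `window_clause_of_lowerEdgeTarget` (the slot window `[f_T(hi) − (τhi/2)g_T(lo), f_T(lo)]·|P_s x|²`) is unconditional;
  **`lowerEdge_second_order`** `vᵀf_T(B)v ≥ (f_T(hi) − (τhi)²/8·h_T(lo))|v|²`, `h_T(a) = T∫∫a(s)a(x)(T(s−x))²e^{−T(s−x)a}` (written out, no new
  definition; relative loss `→ τ²hi³/(4lo³)` as `T → ∞`, the profile's `0.25τ²` (kit j313542) up to `(hi/lo)³`);
  **`abs_form_qsResp_sub_comm_le`** `|xᵀf_T(B)z − zᵀf_T(B)x| ≤ τ·hi·g_T(lo)·√(x·x)√(z·z)` — the SECTOR GROWTH of the slot response: the first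
  conjunct of the per-slot hypothesis `hL1` of `oddSectorial_excQS_strict_of_slot` (sector preservation by `f_T`) is NOT free for non-symmetric
  blocks at finite `T`; this bound gives the response sector `τ_f ≤ τ·hi·g_T(lo)/(f_T(hi) − (τhi/2)g_T(lo))` (`→ τ·(hi/lo)²` for `T → ∞`).
The sharp target `LowerEdgeTargetSharp` (`f_T(hi)/(1 + τ²/4)`) is NOT proved here.  Everything PROVED, no definition, no named fact, no sorry.
Infrastructure for route-1's rung leaf F-D1.A0 (frontier FORMAL rung); NOT a proof of the stub, of the crux, of Onsager's conjecture or of anomalous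
dissipation.  Prover seat `ad-k1l-cellLawV-w1` g2, 2026-08-28.
-/

set_option linter.dupNamespace false

noncomputable section

namespace Summit.AnomalousDissipation.AnomalousDissipation.Theorems.SolenoidalFractalHomogenisation.LagrangianStep.OddGain

open Matrix Finset MeasureTheory Set
open Literature.Analysis.ODE.PeriodicAveraging

/-! ## §3b Pointwise-in-time bounds for a sectorial block: second-order lower edge and the skew part of the semigroup form -/

section Pointwise

/-- **SECOND-ORDER LOWER EDGE, pointwise in time**: sector `τ`, window `[lo, hi]` (`0 < lo`), `t ≥ 0` ⇒
`vᵀe^{-tB}v ≥ (e^{-hi t} − (τhi)²/8·t²·e^{-lo t})·|v|²`.  In the pairing identity at `z = v` the integrand splits as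
`(e^{-(t-r)H}v)·(M e^{-rH}v) + (e^{-(t-r)H}v)·(M w(r))`, `M = ½(Bᵀ − B)`, `w(r) = e^{-rB}v − e^{-rH}v`: the first term is ODD under `r ↦ t − r`
(`M` is skew, `H` symmetric) so its integral vanishes, the second is `≤ (τhi)²/4·r·e^{-lo t}|v|²` by the skew bound, contractivity and
`sqrt_dotProduct_exp_sub_exp_symPart_le`.  Sharp up to the factor `e^{-lo t}` vs `e^{-hi t}` (extremiser `B = hi(𝟙 + (τ/2)[u]_×)`:
`vᵀe^{-tB}v = e^{-hi t}cos(hiτt/2)|v|²`). [folklore] -/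
theorem lowerEdge_pointwise_second {B : Matrix (Fin 3) (Fin 3) ℝ} {τ lo hi : ℝ} (hτ : 0 ≤ τ) (hlo : 0 < lo)
    (hsec : ∀ x z : Fin 3 → ℝ, (x ⬝ᵥ B *ᵥ z - z ⬝ᵥ B *ᵥ x) ^ 2 ≤ τ ^ 2 * ((x ⬝ᵥ B *ᵥ x) * (z ⬝ᵥ B *ᵥ z)))
    (hwin : ∀ x : Fin 3 → ℝ, lo * (x ⬝ᵥ x) ≤ x ⬝ᵥ B *ᵥ x ∧ x ⬝ᵥ B *ᵥ x ≤ hi * (x ⬝ᵥ x)) (v : Fin 3 → ℝ) {t : ℝ}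
    (ht : 0 ≤ t) :
    (Real.exp (-(hi * t)) - (τ * hi) ^ 2 / 8 * t ^ 2 * Real.exp (-(lo * t))) * (v ⬝ᵥ v) ≤
      v ⬝ᵥ ((NormedSpace.exp (-(t • B))) *ᵥ v) := by
  set H : Matrix (Fin 3) (Fin 3) ℝ := (1 / 2 : ℝ) • (B + Bᵀ) with hHdef
  have hH : H.IsSymm := isSymm_symPart B
  have hwinH : ∀ x : Fin 3 → ℝ, lo * (x ⬝ᵥ x) ≤ x ⬝ᵥ H *ᵥ x := fun x => by rw [hHdef, form_symPart_self]; exact (hwin x).1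
  have hwinH' : ∀ x : Fin 3 → ℝ, x ⬝ᵥ H *ᵥ x ≤ hi * (x ⬝ᵥ x) := fun x => by rw [hHdef, form_symPart_self]; exact (hwin x).2
  have hlohi : lo ≤ hi := lo_le_hi_of_window hwin
  have hτhi : 0 ≤ τ * hi := mul_nonneg hτ (hlo.le.trans hlohi)
  have hvv : 0 ≤ v ⬝ᵥ v := by rw [self_dotProduct_eq_sum_sq]; exact Finset.sum_nonneg fun i _ => sq_nonneg _
  -- the pinch on `H` and the pairing identity at `z = v`
  have hpinch := exp_mul_le_dotProduct_exp hH hwinH' v ht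
  have hsym : ((NormedSpace.exp (-(t • H))) *ᵥ v) ⬝ᵥ v = v ⬝ᵥ ((NormedSpace.exp (-(t • H))) *ᵥ v) := dotProduct_comm _ _
  have hid := pairing_identity B H v v t
  rw [hsym] at hid
  -- the two pieces of the integrand
  set M : Matrix (Fin 3) (Fin 3) ℝ := (1 / 2 : ℝ) • (Bᵀ - B) with hMdef
  have hM : Hᵀ - B = M := by rw [hHdef, hMdef]; exact symPart_transpose_sub B
  set F₁ : ℝ → ℝ := fun r => ((NormedSpace.exp (-((t - r) • H))) *ᵥ v) ⬝ᵥ (M *ᵥ ((NormedSpace.exp (-(r • H))) *ᵥ v))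
    with hF₁
  set F₂ : ℝ → ℝ := fun r => ((NormedSpace.exp (-((t - r) • H))) *ᵥ v) ⬝ᵥ
    (M *ᵥ ((NormedSpace.exp (-(r • B))) *ᵥ v - (NormedSpace.exp (-(r • H))) *ᵥ v)) with hF₂
  have hsplit : ∀ r, (H *ᵥ ((NormedSpace.exp (-((t - r) • H))) *ᵥ v)) ⬝ᵥ ((NormedSpace.exp (-(r • B))) *ᵥ v) -
      ((NormedSpace.exp (-((t - r) • H))) *ᵥ v) ⬝ᵥ (B *ᵥ ((NormedSpace.exp (-(r • B))) *ᵥ v)) = F₁ r + F₂ r := by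
    intro r
    rw [pairing_integrand_eq, hM, hF₁, hF₂]
    simp only
    rw [← dotProduct_add, ← Matrix.mulVec_add, add_sub_cancel]
  have hc₁ : Continuous F₁ :=
    (continuous_exp_neg_sub_smul_mulVec H v t).dotProduct (continuous_const.matrix_mulVec (continuous_exp_neg_smul_mulVec H v))
  have hc₂ : Continuous F₂ :=
    (continuous_exp_neg_sub_smul_mulVec H v t).dotProduct (continuous_const.matrix_mulVec
      ((continuous_exp_neg_smul_mulVec B v).sub (continuous_exp_neg_smul_mulVec H v)))
  have hint : ∫ r in (0:ℝ)..t, ((H *ᵥ ((NormedSpace.exp (-((t - r) • H))) *ᵥ v)) ⬝ᵥ ((NormedSpace.exp (-(r • B))) *ᵥ v) -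
      ((NormedSpace.exp (-((t - r) • H))) *ᵥ v) ⬝ᵥ (B *ᵥ ((NormedSpace.exp (-(r • B))) *ᵥ v))) =
      (∫ r in (0:ℝ)..t, F₁ r) + ∫ r in (0:ℝ)..t, F₂ r := by
    rw [← intervalIntegral.integral_add (hc₁.intervalIntegrable _ _) (hc₂.intervalIntegrable _ _)]
    exact intervalIntegral.integral_congr fun r _ => hsplit r
  -- the odd piece integrates to zero
  have hanti : ∀ r, F₁ (t - r) = -F₁ r := by
    intro r
    simp only [hF₁, sub_sub_cancel, hMdef]
    rw [form_skewPart, form_skewPart]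
    ring
  have hzero : ∫ r in (0:ℝ)..t, F₁ r = 0 := by
    have h1 : ∫ r in (0:ℝ)..t, F₁ (t - r) = ∫ r in (0:ℝ)..t, F₁ r := by
      rw [intervalIntegral.integral_comp_sub_left (fun r => F₁ r) t]
      simp only [sub_self, sub_zero]
    have h2 : ∫ r in (0:ℝ)..t, F₁ (t - r) = -∫ r in (0:ℝ)..t, F₁ r := by
      simp_rw [hanti]
      exact intervalIntegral.integral_neg
    linarith
  -- the even piece is second order
  have hbound : ∀ᵐ r : ℝ, r ∈ Set.Ioc (0:ℝ) t → ‖F₂ r‖ ≤ (τ * hi) ^ 2 / 4 * Real.exp (-(lo * t)) * (v ⬝ᵥ v) * r := by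
    refine Filter.Eventually.of_forall fun r hr => ?_
    have hr0 : 0 ≤ r := hr.1.le
    have htr : 0 ≤ t - r := by linarith [hr.2]
    set y := (NormedSpace.exp (-((t - r) • H))) *ᵥ v with hy
    set w := (NormedSpace.exp (-(r • B))) *ᵥ v - (NormedSpace.exp (-(r • H))) *ᵥ v with hw
    rw [Real.norm_eq_abs, hF₂]
    simp only
    rw [hMdef, Matrix.smul_mulVec, dotProduct_smul, smul_eq_mul, abs_mul, abs_of_nonneg (by norm_num : (0:ℝ) ≤ 1 / 2)]
    have hk := abs_dotProduct_skew_le hτ hlo.le hlohi hsec hwin y w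
    have hyb : Real.sqrt (y ⬝ᵥ y) ≤ Real.exp (-(lo * (t - r))) * Real.sqrt (v ⬝ᵥ v) := sqrt_dotProduct_exp_le hwinH v htr
    have hwb : Real.sqrt (w ⬝ᵥ w) ≤ τ * hi / 2 * r * Real.exp (-(lo * r)) * Real.sqrt (v ⬝ᵥ v) := by
      rw [hw, hHdef]; exact sqrt_dotProduct_exp_sub_exp_symPart_le hτ hlo hsec hwin v hr0
    have hexp : Real.exp (-(lo * (t - r))) * Real.exp (-(lo * r)) = Real.exp (-(lo * t)) := by
      rw [← Real.exp_add]; ring_nf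
    have hprod : Real.sqrt (y ⬝ᵥ y) * Real.sqrt (w ⬝ᵥ w) ≤
        τ * hi / 2 * r * Real.exp (-(lo * t)) * (v ⬝ᵥ v) := by
      calc Real.sqrt (y ⬝ᵥ y) * Real.sqrt (w ⬝ᵥ w)
          ≤ (Real.exp (-(lo * (t - r))) * Real.sqrt (v ⬝ᵥ v)) * (τ * hi / 2 * r * Real.exp (-(lo * r)) * Real.sqrt (v ⬝ᵥ v)) :=
            mul_le_mul hyb hwb (Real.sqrt_nonneg _) (mul_nonneg (Real.exp_pos _).le (Real.sqrt_nonneg _))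
        _ = τ * hi / 2 * r * (Real.exp (-(lo * (t - r))) * Real.exp (-(lo * r))) * (Real.sqrt (v ⬝ᵥ v) * Real.sqrt (v ⬝ᵥ v)) := by
            ring
        _ = τ * hi / 2 * r * Real.exp (-(lo * t)) * (v ⬝ᵥ v) := by rw [hexp, Real.mul_self_sqrt hvv]
    calc 1 / 2 * |y ⬝ᵥ ((Bᵀ - B) *ᵥ w)| ≤ 1 / 2 * (τ * hi * (Real.sqrt (y ⬝ᵥ y) * Real.sqrt (w ⬝ᵥ w))) :=
          mul_le_mul_of_nonneg_left hk (by norm_num)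
      _ ≤ 1 / 2 * (τ * hi * (τ * hi / 2 * r * Real.exp (-(lo * t)) * (v ⬝ᵥ v))) :=
          mul_le_mul_of_nonneg_left (mul_le_mul_of_nonneg_left hprod hτhi) (by norm_num)
      _ = (τ * hi) ^ 2 / 4 * Real.exp (-(lo * t)) * (v ⬝ᵥ v) * r := by ring
  have hI := intervalIntegral.norm_integral_le_of_norm_le ht hbound ((continuous_const.mul continuous_id).intervalIntegrable _ _)
  rw [intervalIntegral.integral_const_mul, integral_id, Real.norm_eq_abs] at hI
  have hI' := (abs_le.1 hI).1
  simp only [ne_eq, OfNat.ofNat_ne_zero, not_false_eq_true, zero_pow, sub_zero] at hI'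
  rw [hint, hzero, zero_add] at hid
  linarith [hI', hpinch, hid]

/-- **THE SKEW PART OF THE SEMIGROUP FORM**: sector `τ`, window `[lo, hi]` (`0 < lo`), `t ≥ 0` ⇒
`|z·(e^{-tB}v) − v·(e^{-tB}z)| ≤ τ·hi·t·e^{-lo t}·√(z·z)·√(v·v)` (pairing identity with `C = B`: the integrand is
`(e^{-(t-r)B}z)·((Bᵀ − B)e^{-rB}v)`).  Integrated against the slot kernel this is the sector growth of `f_T`. [folklore] -/
theorem abs_dotProduct_exp_sub_comm_le {B : Matrix (Fin 3) (Fin 3) ℝ} {τ lo hi : ℝ} (hτ : 0 ≤ τ) (hlo : 0 < lo)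
    (hsec : ∀ x z : Fin 3 → ℝ, (x ⬝ᵥ B *ᵥ z - z ⬝ᵥ B *ᵥ x) ^ 2 ≤ τ ^ 2 * ((x ⬝ᵥ B *ᵥ x) * (z ⬝ᵥ B *ᵥ z)))
    (hwin : ∀ x : Fin 3 → ℝ, lo * (x ⬝ᵥ x) ≤ x ⬝ᵥ B *ᵥ x ∧ x ⬝ᵥ B *ᵥ x ≤ hi * (x ⬝ᵥ x)) (z v : Fin 3 → ℝ) {t : ℝ}
    (ht : 0 ≤ t) :
    |z ⬝ᵥ ((NormedSpace.exp (-(t • B))) *ᵥ v) - v ⬝ᵥ ((NormedSpace.exp (-(t • B))) *ᵥ z)| ≤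
      τ * hi * t * Real.exp (-(lo * t)) * (Real.sqrt (z ⬝ᵥ z) * Real.sqrt (v ⬝ᵥ v)) := by
  have hwinB : ∀ x : Fin 3 → ℝ, lo * (x ⬝ᵥ x) ≤ x ⬝ᵥ B *ᵥ x := fun x => (hwin x).1
  have hlohi : lo ≤ hi := lo_le_hi_of_window hwin
  have hτhi : 0 ≤ τ * hi := mul_nonneg hτ (hlo.le.trans hlohi)
  have hsym : ((NormedSpace.exp (-(t • B))) *ᵥ z) ⬝ᵥ v = v ⬝ᵥ ((NormedSpace.exp (-(t • B))) *ᵥ z) := dotProduct_comm _ _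
  rw [← hsym, pairing_identity B B v z t]
  have hbound : ∀ r ∈ Set.uIoc (0:ℝ) t,
      ‖(B *ᵥ ((NormedSpace.exp (-((t - r) • B))) *ᵥ z)) ⬝ᵥ ((NormedSpace.exp (-(r • B))) *ᵥ v) -
        ((NormedSpace.exp (-((t - r) • B))) *ᵥ z) ⬝ᵥ (B *ᵥ ((NormedSpace.exp (-(r • B))) *ᵥ v))‖ ≤
      τ * hi * Real.exp (-(lo * t)) * (Real.sqrt (z ⬝ᵥ z) * Real.sqrt (v ⬝ᵥ v)) := by
    intro r hr
    rw [Set.uIoc_of_le ht] at hr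
    have hr0 : 0 ≤ r := hr.1.le
    have htr : 0 ≤ t - r := by linarith [hr.2]
    set y := (NormedSpace.exp (-((t - r) • B))) *ᵥ z with hy
    set x := (NormedSpace.exp (-(r • B))) *ᵥ v with hx
    rw [Real.norm_eq_abs, pairing_integrand_eq]
    have hk := abs_dotProduct_skew_le hτ hlo.le hlohi hsec hwin y x
    have hyb : Real.sqrt (y ⬝ᵥ y) ≤ Real.exp (-(lo * (t - r))) * Real.sqrt (z ⬝ᵥ z) := sqrt_dotProduct_exp_le hwinB z htr
    have hxb : Real.sqrt (x ⬝ᵥ x) ≤ Real.exp (-(lo * r)) * Real.sqrt (v ⬝ᵥ v) := sqrt_dotProduct_exp_le hwinB v hr0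
    have hexp : Real.exp (-(lo * (t - r))) * Real.exp (-(lo * r)) = Real.exp (-(lo * t)) := by
      rw [← Real.exp_add]; ring_nf
    have hprod : Real.sqrt (y ⬝ᵥ y) * Real.sqrt (x ⬝ᵥ x) ≤ Real.exp (-(lo * t)) * (Real.sqrt (z ⬝ᵥ z) * Real.sqrt (v ⬝ᵥ v)) := by
      calc Real.sqrt (y ⬝ᵥ y) * Real.sqrt (x ⬝ᵥ x)
          ≤ (Real.exp (-(lo * (t - r))) * Real.sqrt (z ⬝ᵥ z)) * (Real.exp (-(lo * r)) * Real.sqrt (v ⬝ᵥ v)) :=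
            mul_le_mul hyb hxb (Real.sqrt_nonneg _) (mul_nonneg (Real.exp_pos _).le (Real.sqrt_nonneg _))
        _ = Real.exp (-(lo * t)) * (Real.sqrt (z ⬝ᵥ z) * Real.sqrt (v ⬝ᵥ v)) := by rw [← hexp]; ring
    calc |y ⬝ᵥ ((Bᵀ - B) *ᵥ x)| ≤ τ * hi * (Real.sqrt (y ⬝ᵥ y) * Real.sqrt (x ⬝ᵥ x)) := hk
      _ ≤ τ * hi * (Real.exp (-(lo * t)) * (Real.sqrt (z ⬝ᵥ z) * Real.sqrt (v ⬝ᵥ v))) := mul_le_mul_of_nonneg_left hprod hτhi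
      _ = τ * hi * Real.exp (-(lo * t)) * (Real.sqrt (z ⬝ᵥ z) * Real.sqrt (v ⬝ᵥ v)) := by ring
  have hI := intervalIntegral.norm_integral_le_of_norm_le_const hbound
  rw [Real.norm_eq_abs, sub_zero, abs_of_nonneg ht] at hI
  calc _ ≤ τ * hi * Real.exp (-(lo * t)) * (Real.sqrt (z ⬝ᵥ z) * Real.sqrt (v ⬝ᵥ v)) * t := hI
    _ = τ * hi * t * Real.exp (-(lo * t)) * (Real.sqrt (z ⬝ᵥ z) * Real.sqrt (v ⬝ᵥ v)) := by ring

end Pointwise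

/-! ## §4 Kernel integration: the slot functional `g ↦ T∫₀¹a(s)∫₀ˢa(x) g(T(s−x))` is monotone and linear; the targets -/

section Kernel

open Literature.Analysis Literature.Analysis.FunctionSpaces Literature.Analysis.FluidPDE
open Literature.Analysis.FluidPDE.LatticeShear

/-- Joint continuity of `(s, x) ↦ a(x)·k(T(s−x))` for continuous `k`. [folklore] -/
theorem continuous_uncurry_qsKernel (ρ T : ℝ) {k : ℝ → ℝ} (hk : Continuous k) :
    Continuous (Function.uncurry fun s x : ℝ => LatticeShear.LatticeWord.trapezoid 0 1 ρ x * k (T * (s - x))) :=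
  ((continuous_trapezoid_unit ρ).comp continuous_snd).mul (hk.comp (by fun_prop : Continuous fun p : ℝ × ℝ => T * (p.1 - p.2)))

/-- The inner slot integrand is interval integrable. [folklore] -/
theorem intervalIntegrable_qsKernel_inner (ρ T : ℝ) {k : ℝ → ℝ} (hk : Continuous k) (s : ℝ) :
    IntervalIntegrable (fun x : ℝ => LatticeShear.LatticeWord.trapezoid 0 1 ρ x * k (T * (s - x))) volume 0 s :=
  ((continuous_trapezoid_unit ρ).mul (hk.comp (by fun_prop : Continuous fun x : ℝ => T * (s - x)))).intervalIntegrable _ _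

/-- The outer slot integrand is interval integrable (Mathlib's `continuous_parametric_intervalIntegral_of_continuous`). [folklore] -/
theorem intervalIntegrable_qsKernel_outer (ρ T : ℝ) {k : ℝ → ℝ} (hk : Continuous k) :
    IntervalIntegrable (fun s : ℝ => LatticeShear.LatticeWord.trapezoid 0 1 ρ s *
      ∫ x in (0:ℝ)..s, LatticeShear.LatticeWord.trapezoid 0 1 ρ x * k (T * (s - x))) volume 0 1 :=
  ((continuous_trapezoid_unit ρ).mul
    (intervalIntegral.continuous_parametric_intervalIntegral_of_continuous (a₀ := 0) (continuous_uncurry_qsKernel ρ T hk)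
      continuous_id)).intervalIntegrable _ _

/-- **The slot functional is MONOTONE** on profiles compared on `t ≥ 0` (`T ≥ 0`; the weights `T·a(s)·a(x)` are non-negative and
`T(s − x) ≥ 0` on the triangle) — the two-rate variant of p643071's `le_sum_sum_mul_qsResp_mul`. [folklore] -/
theorem qsKernel_mono {ρ T : ℝ} (hT : 0 ≤ T) {g h : ℝ → ℝ} (hg : Continuous g) (hh : Continuous h)
    (hle : ∀ t : ℝ, 0 ≤ t → g t ≤ h t) :
    T * ∫ s in (0:ℝ)..1, LatticeShear.LatticeWord.trapezoid 0 1 ρ s *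
        ∫ x in (0:ℝ)..s, LatticeShear.LatticeWord.trapezoid 0 1 ρ x * g (T * (s - x)) ≤
    T * ∫ s in (0:ℝ)..1, LatticeShear.LatticeWord.trapezoid 0 1 ρ s *
        ∫ x in (0:ℝ)..s, LatticeShear.LatticeWord.trapezoid 0 1 ρ x * h (T * (s - x)) := by
  refine mul_le_mul_of_nonneg_left ?_ hT
  refine intervalIntegral.integral_mono_on zero_le_one (intervalIntegrable_qsKernel_outer ρ T hg)
    (intervalIntegrable_qsKernel_outer ρ T hh) fun s hs => ?_
  refine mul_le_mul_of_nonneg_left ?_ (trapezoid_unit_nonneg ρ s)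
  refine intervalIntegral.integral_mono_on hs.1 (intervalIntegrable_qsKernel_inner ρ T hg s)
    (intervalIntegrable_qsKernel_inner ρ T hh s) fun x hx => ?_
  exact mul_le_mul_of_nonneg_left (hle _ (mul_nonneg hT (by linarith [hx.2]))) (trapezoid_unit_nonneg ρ x)

/-- **The slot functional is LINEAR**: `Φ(a·g + b·h) = a·Φ(g) + b·Φ(h)`. [folklore] -/
theorem qsKernel_lin (ρ T : ℝ) {g h : ℝ → ℝ} (hg : Continuous g) (hh : Continuous h) (a b : ℝ) :
    T * ∫ s in (0:ℝ)..1, LatticeShear.LatticeWord.trapezoid 0 1 ρ s *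
        ∫ x in (0:ℝ)..s, LatticeShear.LatticeWord.trapezoid 0 1 ρ x * (a * g (T * (s - x)) + b * h (T * (s - x))) =
    a * (T * ∫ s in (0:ℝ)..1, LatticeShear.LatticeWord.trapezoid 0 1 ρ s *
        ∫ x in (0:ℝ)..s, LatticeShear.LatticeWord.trapezoid 0 1 ρ x * g (T * (s - x))) +
    b * (T * ∫ s in (0:ℝ)..1, LatticeShear.LatticeWord.trapezoid 0 1 ρ s *
        ∫ x in (0:ℝ)..s, LatticeShear.LatticeWord.trapezoid 0 1 ρ x * h (T * (s - x))) := by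
  have hinner : ∀ s : ℝ, ∫ x in (0:ℝ)..s, LatticeShear.LatticeWord.trapezoid 0 1 ρ x * (a * g (T * (s - x)) + b * h (T * (s - x))) =
      a * (∫ x in (0:ℝ)..s, LatticeShear.LatticeWord.trapezoid 0 1 ρ x * g (T * (s - x))) +
      b * ∫ x in (0:ℝ)..s, LatticeShear.LatticeWord.trapezoid 0 1 ρ x * h (T * (s - x)) := by
    intro s
    rw [← intervalIntegral.integral_const_mul, ← intervalIntegral.integral_const_mul,
      ← intervalIntegral.integral_add ((intervalIntegrable_qsKernel_inner ρ T hg s).const_mul a)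
        ((intervalIntegrable_qsKernel_inner ρ T hh s).const_mul b)]
    refine intervalIntegral.integral_congr fun x _ => ?_
    ring
  have houter : ∫ s in (0:ℝ)..1, LatticeShear.LatticeWord.trapezoid 0 1 ρ s *
        ∫ x in (0:ℝ)..s, LatticeShear.LatticeWord.trapezoid 0 1 ρ x * (a * g (T * (s - x)) + b * h (T * (s - x))) =
      a * (∫ s in (0:ℝ)..1, LatticeShear.LatticeWord.trapezoid 0 1 ρ s *
        ∫ x in (0:ℝ)..s, LatticeShear.LatticeWord.trapezoid 0 1 ρ x * g (T * (s - x))) +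
      b * ∫ s in (0:ℝ)..1, LatticeShear.LatticeWord.trapezoid 0 1 ρ s *
        ∫ x in (0:ℝ)..s, LatticeShear.LatticeWord.trapezoid 0 1 ρ x * h (T * (s - x)) := by
    rw [← intervalIntegral.integral_const_mul, ← intervalIntegral.integral_const_mul,
      ← intervalIntegral.integral_add ((intervalIntegrable_qsKernel_outer ρ T hg).const_mul a)
        ((intervalIntegrable_qsKernel_outer ρ T hh).const_mul b)]
    refine intervalIntegral.integral_congr fun s _ => ?_
    rw [hinner s]
    ring
  rw [houter]
  ring

/-- **The bilinear form of `qsResp` through the slot functional** (p643071's `sum_sum_mul_qsResp_mul` in the `⬝ᵥ` currency). [folklore] -/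
theorem form_qsResp_eq (ρ T : ℝ) (B : Matrix (Fin 3) (Fin 3) ℝ) (v w : Fin 3 → ℝ) :
    v ⬝ᵥ (qsResp ρ T B) *ᵥ w = T * ∫ s in (0:ℝ)..1, LatticeShear.LatticeWord.trapezoid 0 1 ρ s *
        ∫ x in (0:ℝ)..s, LatticeShear.LatticeWord.trapezoid 0 1 ρ x *
          (v ⬝ᵥ (NormedSpace.exp (-((T * (s - x)) • B))) *ᵥ w) := by
  rw [← sum_sum_eq_form, sum_sum_mul_qsResp_mul]
  simp_rw [sum_sum_eq_form, neg_smul]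

/-- **`LowerEdgeTarget` HOLDS** (for every ramp `ρ`): the first-order lower window edge for sectorial blocks,
`vᵀ f_T(B) v ≥ (f_T(hi) − (τhi/2)·g_T(lo))·|v|²` — `lowerEdge_pointwise_first` integrated against the slot kernel
(`qsKernel_mono`, `qsKernel_lin`).  Closes `window_clause_of_lowerEdgeTarget` (p5 §5) unconditionally. [folklore] -/
theorem lowerEdgeTarget_holds (ρ : ℝ) : LowerEdgeTarget ρ := by
  intro T hT B τ lo hi hτ hlo hsec hwin v
  have hle : ∀ t : ℝ, 0 ≤ t → (v ⬝ᵥ v) * Real.exp (-t * hi) + (-(τ * hi / 2 * (v ⬝ᵥ v))) * (t * Real.exp (-t * lo)) ≤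
      v ⬝ᵥ (NormedSpace.exp (-(t • B))) *ᵥ v := by
    intro t ht
    have h := lowerEdge_pointwise_first hτ hlo hsec hwin v ht
    have e1 : Real.exp (-t * hi) = Real.exp (-(hi * t)) := by congr 1; ring
    have e2 : Real.exp (-t * lo) = Real.exp (-(lo * t)) := by congr 1; ring
    rw [e1, e2]
    linarith
  have hg : Continuous fun t : ℝ => (v ⬝ᵥ v) * Real.exp (-t * hi) + (-(τ * hi / 2 * (v ⬝ᵥ v))) * (t * Real.exp (-t * lo)) := by
    fun_prop
  have hh : Continuous fun t : ℝ => v ⬝ᵥ (NormedSpace.exp (-(t • B))) *ᵥ v :=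
    continuous_const.dotProduct (continuous_exp_neg_smul_mulVec B v)
  have hmono := qsKernel_mono (ρ := ρ) hT hg hh hle
  have hlin := qsKernel_lin ρ T (by fun_prop : Continuous fun t : ℝ => Real.exp (-t * hi))
    (by fun_prop : Continuous fun t : ℝ => t * Real.exp (-t * lo)) (v ⬝ᵥ v) (-(τ * hi / 2 * (v ⬝ᵥ v)))
  have key : (v ⬝ᵥ v) * qsRespScalar ρ T hi + (-(τ * hi / 2 * (v ⬝ᵥ v))) * qsRespMoment ρ T lo ≤
      v ⬝ᵥ (qsResp ρ T B) *ᵥ v := by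
    rw [form_qsResp_eq]
    unfold qsRespScalar qsRespMoment
    rw [← hlin]
    exact hmono
  linarith

/-- **SECOND-ORDER LOWER EDGE**: `vᵀ f_T(B) v ≥ (f_T(hi) − (τhi)²/8·h_T(lo))·|v|²` with the second kernel moment
`h_T(a) = T∫₀¹a(s)∫₀ˢa(x)(T(s−x))²e^{−T(s−x)a}` (written out; `→ 2ϑ_∞/a³` for `Ta ≫ 1`): relative loss `τ²hi³/(4lo³)·(1 − O(1/T))`,
the profile's `0.25τ²` at `hi = lo`. [folklore] -/
theorem lowerEdge_second_order {ρ T : ℝ} (hT : 0 ≤ T) {B : Matrix (Fin 3) (Fin 3) ℝ} {τ lo hi : ℝ} (hτ : 0 ≤ τ) (hlo : 0 < lo)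
    (hsec : ∀ x z : Fin 3 → ℝ, (x ⬝ᵥ B *ᵥ z - z ⬝ᵥ B *ᵥ x) ^ 2 ≤ τ ^ 2 * ((x ⬝ᵥ B *ᵥ x) * (z ⬝ᵥ B *ᵥ z)))
    (hwin : ∀ x : Fin 3 → ℝ, lo * (x ⬝ᵥ x) ≤ x ⬝ᵥ B *ᵥ x ∧ x ⬝ᵥ B *ᵥ x ≤ hi * (x ⬝ᵥ x)) (v : Fin 3 → ℝ) :
    (qsRespScalar ρ T hi - (τ * hi) ^ 2 / 8 * (T * ∫ s in (0:ℝ)..1, LatticeShear.LatticeWord.trapezoid 0 1 ρ s *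
        ∫ x in (0:ℝ)..s, LatticeShear.LatticeWord.trapezoid 0 1 ρ x * ((T * (s - x)) ^ 2 * Real.exp (-(T * (s - x)) * lo)))) *
      (v ⬝ᵥ v) ≤ v ⬝ᵥ (qsResp ρ T B) *ᵥ v := by
  have hle : ∀ t : ℝ, 0 ≤ t → (v ⬝ᵥ v) * Real.exp (-t * hi) + (-((τ * hi) ^ 2 / 8 * (v ⬝ᵥ v))) * (t ^ 2 * Real.exp (-t * lo)) ≤
      v ⬝ᵥ (NormedSpace.exp (-(t • B))) *ᵥ v := by
    intro t ht
    have h := lowerEdge_pointwise_second hτ hlo hsec hwin v ht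
    have e1 : Real.exp (-t * hi) = Real.exp (-(hi * t)) := by congr 1; ring
    have e2 : Real.exp (-t * lo) = Real.exp (-(lo * t)) := by congr 1; ring
    rw [e1, e2]
    linarith
  have hg : Continuous fun t : ℝ => (v ⬝ᵥ v) * Real.exp (-t * hi) + (-((τ * hi) ^ 2 / 8 * (v ⬝ᵥ v))) * (t ^ 2 * Real.exp (-t * lo)) := by
    fun_prop
  have hh : Continuous fun t : ℝ => v ⬝ᵥ (NormedSpace.exp (-(t • B))) *ᵥ v :=
    continuous_const.dotProduct (continuous_exp_neg_smul_mulVec B v)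
  have hmono := qsKernel_mono (ρ := ρ) hT hg hh hle
  have hlin := qsKernel_lin ρ T (by fun_prop : Continuous fun t : ℝ => Real.exp (-t * hi))
    (by fun_prop : Continuous fun t : ℝ => t ^ 2 * Real.exp (-t * lo)) (v ⬝ᵥ v) (-((τ * hi) ^ 2 / 8 * (v ⬝ᵥ v)))
  have key : (v ⬝ᵥ v) * qsRespScalar ρ T hi + (-((τ * hi) ^ 2 / 8 * (v ⬝ᵥ v))) *
      (T * ∫ s in (0:ℝ)..1, LatticeShear.LatticeWord.trapezoid 0 1 ρ s *
        ∫ x in (0:ℝ)..s, LatticeShear.LatticeWord.trapezoid 0 1 ρ x * ((T * (s - x)) ^ 2 * Real.exp (-(T * (s - x)) * lo))) ≤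
      v ⬝ᵥ (qsResp ρ T B) *ᵥ v := by
    rw [form_qsResp_eq]
    unfold qsRespScalar
    rw [← hlin]
    exact hmono
  linarith

/-- **SECTOR GROWTH OF THE SLOT RESPONSE**: for a block `B` in the Kato sector `τ` with window `[lo, hi]` (`0 < lo`) and `T ≥ 0`,
the skew part of the form of `f_T(B) = qsResp ρ T B` is first order: `|xᵀf_T(B)z − zᵀf_T(B)x| ≤ τ·hi·g_T(lo)·√(x·x)√(z·z)`
(`abs_dotProduct_exp_sub_comm_le` integrated; `g_T = qsRespMoment`). [folklore] -/
theorem abs_form_qsResp_sub_comm_le {ρ T : ℝ} (hT : 0 ≤ T) {B : Matrix (Fin 3) (Fin 3) ℝ} {τ lo hi : ℝ} (hτ : 0 ≤ τ) (hlo : 0 < lo)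
    (hsec : ∀ x z : Fin 3 → ℝ, (x ⬝ᵥ B *ᵥ z - z ⬝ᵥ B *ᵥ x) ^ 2 ≤ τ ^ 2 * ((x ⬝ᵥ B *ᵥ x) * (z ⬝ᵥ B *ᵥ z)))
    (hwin : ∀ x : Fin 3 → ℝ, lo * (x ⬝ᵥ x) ≤ x ⬝ᵥ B *ᵥ x ∧ x ⬝ᵥ B *ᵥ x ≤ hi * (x ⬝ᵥ x)) (x z : Fin 3 → ℝ) :
    |x ⬝ᵥ (qsResp ρ T B) *ᵥ z - z ⬝ᵥ (qsResp ρ T B) *ᵥ x| ≤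
      τ * hi * qsRespMoment ρ T lo * (Real.sqrt (x ⬝ᵥ x) * Real.sqrt (z ⬝ᵥ z)) := by
  set C := τ * hi * (Real.sqrt (x ⬝ᵥ x) * Real.sqrt (z ⬝ᵥ z)) with hC
  have hpt : ∀ t : ℝ, 0 ≤ t → |x ⬝ᵥ (NormedSpace.exp (-(t • B))) *ᵥ z - z ⬝ᵥ (NormedSpace.exp (-(t • B))) *ᵥ x| ≤
      C * (t * Real.exp (-t * lo)) := by
    intro t ht
    have h := abs_dotProduct_exp_sub_comm_le hτ hlo hsec hwin x z ht
    have e2 : Real.exp (-t * lo) = Real.exp (-(lo * t)) := by congr 1; ring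
    rw [e2, hC]
    calc _ ≤ τ * hi * t * Real.exp (-(lo * t)) * (Real.sqrt (x ⬝ᵥ x) * Real.sqrt (z ⬝ᵥ z)) := h
      _ = τ * hi * (Real.sqrt (x ⬝ᵥ x) * Real.sqrt (z ⬝ᵥ z)) * (t * Real.exp (-(lo * t))) := by ring
  have hgx : Continuous fun t : ℝ => x ⬝ᵥ (NormedSpace.exp (-(t • B))) *ᵥ z :=
    continuous_const.dotProduct (continuous_exp_neg_smul_mulVec B z)
  have hgz : Continuous fun t : ℝ => z ⬝ᵥ (NormedSpace.exp (-(t • B))) *ᵥ x :=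
    continuous_const.dotProduct (continuous_exp_neg_smul_mulVec B x)
  have hm : Continuous fun t : ℝ => t * Real.exp (-t * lo) := by fun_prop
  -- upper: Φ(1·g − 1·h) ≤ Φ(C·m + 0·m)
  have hup := qsKernel_mono (ρ := ρ) hT ((continuous_const.mul hgx).add (continuous_const.mul hgz))
    ((continuous_const.mul hm).add (continuous_const.mul hm))
    (g := fun t => 1 * (x ⬝ᵥ (NormedSpace.exp (-(t • B))) *ᵥ z) + (-1) * (z ⬝ᵥ (NormedSpace.exp (-(t • B))) *ᵥ x))
    (h := fun t => C * (t * Real.exp (-t * lo)) + 0 * (t * Real.exp (-t * lo)))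
    (fun t ht => by have := (abs_le.1 (hpt t ht)).2; linarith)
  -- lower: Φ((−1)·g + 1·h) ≤ Φ(C·m + 0·m)
  have hlow := qsKernel_mono (ρ := ρ) hT ((continuous_const.mul hgx).add (continuous_const.mul hgz))
    ((continuous_const.mul hm).add (continuous_const.mul hm))
    (g := fun t => (-1) * (x ⬝ᵥ (NormedSpace.exp (-(t • B))) *ᵥ z) + 1 * (z ⬝ᵥ (NormedSpace.exp (-(t • B))) *ᵥ x))
    (h := fun t => C * (t * Real.exp (-t * lo)) + 0 * (t * Real.exp (-t * lo)))
    (fun t ht => by have := (abs_le.1 (hpt t ht)).1; linarith)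
  rw [qsKernel_lin ρ T hgx hgz, qsKernel_lin ρ T hm hm] at hup
  rw [qsKernel_lin ρ T hgx hgz, qsKernel_lin ρ T hm hm] at hlow
  rw [← form_qsResp_eq, ← form_qsResp_eq] at hup hlow
  unfold qsRespMoment
  rw [abs_le]
  constructor <;> linarith

end Kernel

end Summit.AnomalousDissipation.AnomalousDissipation.Theorems.SolenoidalFractalHomogenisation.LagrangianStep.OddGain

end
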